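/-
Literature/Probability/FitznerVanDerHofstad2017/SrwWSplitJensen.lean   (NEW, additive, d-generic)

b2b-lace lean1-g22, node N67-S2-K2d-J: the PRODUCT-JENSEN bound on the `W`-split far node
`W_{n,j}(x) = ∫ D̂^{2j} Ĉⁿ [D̂^{(x)}]²` of [FvdH-NoBLE (5.16)] — a HYPOTHESIS-FREE upper bound by a dyadic
average of the tabulated integrals `I_{n,2j}(y)` over the "doubled restrictions" `y = 2·x|_T`, `T ⊆ supp x`.
What-if / input-certification lane: no statement about any dimension; the record (CERT REV 14) is untouched.
-/
import Mathlib.Algebra.Order.Chebyshev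
import Literature.Probability.FitznerVanDerHofstad2017.SrwIntegralOrbit
import Literature.Probability.FitznerVanDerHofstad2017.SrwFarNodeBound
import HarnessLib

/-!
# The `W`-split far node under the product-Jensen inequality

[FvdH-NoBLE, §5.1.2 (5.16) p. 1092] bounds the far node `K_{n,m+j}(x) ≤ √(I_{n,2m}(0))·√(W_{n,j}(x))`
(`SrwIntegralWSplit.srwK_le_sqrt_srwI_mul_srwW`), where `W_{n,j}(x) = ∫ D̂^{2j} Ĉⁿ [D̂^{(x)}]²` needs a
`2^d d!`-term orbit sum to be evaluated exactly (`SrwIntegralOrbit.srwW_eq_orbit_sum`).  This module proves a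
cheap rigorous MAJORANT of `W` by tabulated one-point integrals:

* §1 `sum_units_cos_sum`: `Σ_{δ ∈ {±1}^d} cos(Σ_j δ_j a_j) = 2^d Π_j cos a_j`, whence the permutation form
  `DhatSym_eq_sum_permProd`: `D̂^{(x)}(k) = (d!)⁻¹ Σ_{ν ∈ S_d} Π_j cos(x_{ν j} k_j)`.
* §2 `permProd_sq` (exact): `(Π_j cos(x_{νj} k_j))² = 2^{-s} Σ_{T ⊆ S} Π_j cos((2x|_T)_{νj} k_j)` with
  `S = supp x`, `s = #S` (`cos² u = (1 + cos 2u)/2` and `Π_{i∈S}(1 + c_i) = Σ_{T⊆S} Π_{i∈T} c_i`), and the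
  Cauchy–Schwarz/Jensen step over `ν`: `DhatSym_sq_le`:
  `[D̂^{(x)}(k)]² ≤ 2^{-s} Σ_{T ⊆ S} D̂^{(2x|_T)}(k)`.
* §3 integrating against `D̂^{2j} Ĉⁿ ≥ 0`: `srwW_le_jensenSum`:
  `W_{n,j}(x) ≤ 2^{-s} Σ_{T ⊆ supp x} I_{n,2j}(2·x|_T)` (`2n+1 ≤ d`), and the far-node certificates
  `srwK_le_sqrt_mul_sqrt_jensen`, `srwK_le_of_jensen_cert` (`A ≥ I_{n,2m}(0)`, `B ≥` the Jensen sum,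
  `A·B ≤ F²` ⟹ `K_{n,m+j}(x) ≤ F`) and the AM–GM form `srwK_le_half_add_of_jensen` (`K ≤ (A+B)/2`).
  The `T = ∅` term is `I_{n,2j}(0)`; every term is `≤ I_{n,2j}(0)` (`srwI_le_srwI_zero`), so the bound never
  exceeds the `x`-uniform cap `I_{n,2j}(0)` of (5.14) (`jensenSum_le_srwI_zero`), and it is strictly smaller as
  soon as one doubled restriction has a smaller integral.

How a consumer uses it: the `K`-level far-value hook of the `WBX` cell
(`WbxCellExactKernel.toReal_tsum_sq_weighted_repBubble_le_policyXBounds_of_farValues`, binder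
`hF : K_{1,2J}(x_l) ≤ F`) is discharged class by class by `srwK_le_half_add_of_jensen` /
`srwK_le_of_jensen_cert` from a certified origin value `A` (an origin `I`-table row, extended by
`SrwOriginTailKernel.srwIZeroExtQ`) and certified values of the `2^s` integrals `I_{1,2j}(2·x_l|_T)` (each an
SRW-law partial sum plus an origin tail, `SrwOriginTailKernel.srwI_one_le_partialQ_add_extQ`; they depend on `T`
only through the type `(#T ∩ block_a)_a`, `SrwIntegralB3Transport.srwI_spAct`).

All statements are `d`-generic.  Pointer language only.

References: [FvdH-NoBLE] R. Fitzner, R. van der Hofstad, "Generalized approach to the non-backtracking lace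
expansion", PTRF 169 (2017) 1041–1119, §3.5.3, §5.1.2; [FvdH17] —, "Mean-field behavior for nearest-neighbor
percolation in d > 10", EJP 22 (2017) no. 43, §4.2.
-/

namespace Literature.Probability.FitznerVanDerHofstad2017

open MeasureTheory Finset Real
open Literature.Barriers.CriticalPhenomena
open Literature.Barriers.CriticalPhenomena.Slade2006Prop53 (P)

variable {d : ℕ}

/-! ### §1. `D̂^{(x)}` as a permutation average of coordinate products -/

/-- The sign average factorises: `Σ_{δ ∈ {±1}^d} cos(Σ_j δ_j a_j) = 2^d · Π_j cos(a_j)`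
(real part of `Σ_δ Π_j e^{i δ_j a_j} = Π_j (e^{i a_j} + e^{-i a_j})`) — the sign average inside the symmetrisation
(3.35). [cite: FitznerVanDerHofstad2016NoBLE, §3.5.3 (3.35) p. 1071] -/
theorem sum_units_cos_sum (a : Fin d → ℝ) :
    ∑ δ : Fin d → ℤˣ, Real.cos (∑ j, ((δ j : ℤ) : ℝ) * a j) = 2 ^ d * ∏ j, Real.cos (a j) := by
  classical
  have hunits : (Finset.univ : Finset ℤˣ) = {1, -1} := by decide
  have h2 : ∀ t : ℝ, Complex.exp ((t : ℂ) * Complex.I) + Complex.exp (((-t : ℝ) : ℂ) * Complex.I) =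
      ((2 * Real.cos t : ℝ) : ℂ) := by
    intro t
    rw [Complex.exp_mul_I, Complex.exp_mul_I]
    push_cast
    rw [Complex.cos_neg, Complex.sin_neg]
    ring
  have hC : ∑ δ : Fin d → ℤˣ, Complex.exp (((∑ j, ((δ j : ℤ) : ℝ) * a j : ℝ) : ℂ) * Complex.I) =
      ((∏ j : Fin d, (2 * Real.cos (a j)) : ℝ) : ℂ) := by
    have h1 : ∀ δ : Fin d → ℤˣ, Complex.exp (((∑ j, ((δ j : ℤ) : ℝ) * a j : ℝ) : ℂ) * Complex.I) =
        ∏ j, Complex.exp ((((((δ j : ℤ) : ℝ) * a j : ℝ)) : ℂ) * Complex.I) := by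
      intro δ
      rw [← Complex.exp_sum, Complex.ofReal_sum, Finset.sum_mul]
    simp_rw [h1]
    rw [← Fintype.prod_sum fun j (u : ℤˣ) => Complex.exp (((((u : ℤ) : ℝ) * a j : ℝ) : ℂ) * Complex.I),
      Complex.ofReal_prod]
    refine Finset.prod_congr rfl fun j _ => ?_
    rw [hunits, Finset.sum_pair (by decide), ← h2 (a j)]
    simp
  have hre := congrArg Complex.re hC
  rw [Complex.re_sum, Complex.ofReal_re] at hre
  simp_rw [Complex.exp_ofReal_mul_I_re] at hre
  rw [hre, Finset.prod_mul_distrib, Finset.prod_const, Finset.card_univ, Fintype.card_fin]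

/-- The coordinate product of one permutation: `P_ν(x; k) = Π_j cos(x_{ν j} · k_j)`. [folklore] -/
noncomputable def permProd (x : Fin d → ℤ) (k : Fin d → ℝ) (ν : Equiv.Perm (Fin d)) : ℝ :=
  ∏ j, Real.cos ((x (ν j) : ℝ) * k j)

/-- **Permutation form of the symmetrised character**: `D̂^{(x)}(k) = (d!)⁻¹ Σ_{ν ∈ S_d} Π_j cos(x_{νj} k_j)`.
[cite: FitznerVanDerHofstad2016NoBLE, §3.5.3 (3.35) p. 1071] -/
theorem DhatSym_eq_sum_permProd (x : Fin d → ℤ) (k : Fin d → ℝ) :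
    DhatSym d x k = (∑ ν : Equiv.Perm (Fin d), permProd x k ν) / d.factorial := by
  rw [DhatSym_def]
  have h : ∀ ν : Equiv.Perm (Fin d),
      ∑ δ : Fin d → ℤˣ, Real.cos (∑ j, ((δ j : ℤ) : ℝ) * (x (ν j) : ℝ) * k j) = 2 ^ d * permProd x k ν := by
    intro ν
    have := sum_units_cos_sum (fun j => (x (ν j) : ℝ) * k j)
    simp only [← mul_assoc] at this
    exact this
  simp_rw [h]
  rw [← Finset.mul_sum, mul_div_mul_left _ _ (by positivity)]

/-- Re-indexing by the permutation: `Π_j cos(x_{νj} k_j) = Π_i cos(x_i k_{ν⁻¹ i})` (the permutation average in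
(3.35)). [cite: FitznerVanDerHofstad2016NoBLE, §3.5.3 (3.35) p. 1071] -/
theorem permProd_eq_prod_symm (x : Fin d → ℤ) (k : Fin d → ℝ) (ν : Equiv.Perm (Fin d)) :
    permProd x k ν = ∏ i, Real.cos ((x i : ℝ) * k (ν.symm i)) := by
  unfold permProd
  exact Fintype.prod_equiv ν _ _ fun j => by simp

/-! ### §2. The exact square of a coordinate product and the Jensen step -/

/-- The support of a lattice point: `supp x = {i | x_i ≠ 0}`. [folklore] -/
def nzSupp (x : Fin d → ℤ) : Finset (Fin d) := Finset.univ.filter fun i => x i ≠ 0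

/-- The doubled restriction `2·x|_T`: `(2x|_T)_i = 2 x_i` on `T`, `0` off `T`. [folklore] -/
def dblOn (x : Fin d → ℤ) (T : Finset (Fin d)) : Fin d → ℤ := fun i => if i ∈ T then 2 * x i else 0

/-- On `T` the doubled restriction doubles. [cite: FitznerVanDerHofstad2016NoBLE, §5.1.2 (5.16) p. 1092] -/
@[simp] theorem dblOn_apply_of_mem {x : Fin d → ℤ} {T : Finset (Fin d)} {i : Fin d} (h : i ∈ T) :
    dblOn x T i = 2 * x i := if_pos h

/-- Off `T` the doubled restriction vanishes. [cite: FitznerVanDerHofstad2016NoBLE, §5.1.2 (5.16) p. 1092] -/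
@[simp] theorem dblOn_apply_of_not_mem {x : Fin d → ℤ} {T : Finset (Fin d)} {i : Fin d} (h : i ∉ T) :
    dblOn x T i = 0 := if_neg h

/-- `2·x|_∅ = 0` (the `T = ∅` term of the Jensen sum is the origin). [cite: FitznerVanDerHofstad2016NoBLE, §5.1.2 (5.16) p. 1092] -/
@[simp] theorem dblOn_empty (x : Fin d → ℤ) : dblOn x ∅ = 0 := by
  funext i; simp [dblOn]

/-- **The exact square** (per permutation): with `S = supp x`, `s = #S`,
`(Π_j cos(x_{νj} k_j))² = 2^{-s} · Σ_{T ⊆ S} Π_j cos((2x|_T)_{νj} k_j)`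
(`cos² u = (1 + cos 2u)/2` on `S`, the factors off `S` being `1`, and `Π_{i∈S}(1 + c_i) = Σ_{T⊆S} Π_{i∈T} c_i`) —
the square of one permutation term of (3.35). [cite: FitznerVanDerHofstad2016NoBLE, §3.5.3 (3.35) p. 1071; §5.1.2 (5.16) p. 1092] -/
theorem permProd_sq (x : Fin d → ℤ) (k : Fin d → ℝ) (ν : Equiv.Perm (Fin d)) :
    permProd x k ν ^ 2 = (∑ T ∈ (nzSupp x).powerset, permProd (dblOn x T) k ν) / 2 ^ (nzSupp x).card := by
  rw [permProd_eq_prod_symm, ← Finset.prod_pow]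
  have hS : ∏ i, Real.cos ((x i : ℝ) * k (ν.symm i)) ^ 2 =
      ∏ i ∈ nzSupp x, Real.cos ((x i : ℝ) * k (ν.symm i)) ^ 2 := by
    refine (Finset.prod_subset (Finset.subset_univ _) fun i _ hi => ?_).symm
    have : x i = 0 := by simpa [nzSupp] using hi
    simp [this]
  have hcos : ∀ i, Real.cos ((x i : ℝ) * k (ν.symm i)) ^ 2 =
      (1 + Real.cos (((2 * x i : ℤ) : ℝ) * k (ν.symm i))) / 2 := by
    intro i
    rw [Real.cos_sq, show ((2 * x i : ℤ) : ℝ) * k (ν.symm i) = 2 * ((x i : ℝ) * k (ν.symm i)) by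
      push_cast; ring]
    ring
  rw [hS]
  simp_rw [hcos]
  rw [Finset.prod_div_distrib, Finset.prod_const, Finset.prod_one_add]
  congr 1
  refine Finset.sum_congr rfl fun T _ => ?_
  rw [permProd_eq_prod_symm, ← Finset.prod_subset (Finset.subset_univ T)
    (f := fun i => Real.cos (((dblOn x T i : ℤ) : ℝ) * k (ν.symm i))) (fun i _ hi => by simp [dblOn, hi])]
  exact Finset.prod_congr rfl fun i hi => by simp [dblOn, hi]

/-- **Product-Jensen**: `[D̂^{(x)}(k)]² ≤ 2^{-s} Σ_{T ⊆ supp x} D̂^{(2x|_T)}(k)`, `s = # supp x`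
(Cauchy–Schwarz over the `d!` permutations in `DhatSym_eq_sum_permProd`, then `permProd_sq` term by term).
[cite: FitznerVanDerHofstad2016NoBLE, §3.5.3 (3.35) p. 1071; §5.1.2 (5.16) p. 1092] -/
theorem DhatSym_sq_le (x : Fin d → ℤ) (k : Fin d → ℝ) :
    DhatSym d x k ^ 2 ≤ (∑ T ∈ (nzSupp x).powerset, DhatSym d (dblOn x T) k) / 2 ^ (nzSupp x).card := by
  have hfac : (0 : ℝ) < d.factorial := by positivity
  have hcs := sq_sum_le_card_mul_sum_sq (s := (Finset.univ : Finset (Equiv.Perm (Fin d))))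
    (f := permProd x k)
  rw [Finset.card_univ, Fintype.card_perm, Fintype.card_fin] at hcs
  rw [DhatSym_eq_sum_permProd, div_pow]
  calc (∑ ν, permProd x k ν) ^ 2 / (d.factorial : ℝ) ^ 2
      ≤ (d.factorial * ∑ ν, permProd x k ν ^ 2) / (d.factorial : ℝ) ^ 2 :=
        div_le_div_of_nonneg_right hcs (by positivity)
    _ = (∑ ν, permProd x k ν ^ 2) / d.factorial := by rw [sq, mul_div_mul_left _ _ hfac.ne']
    _ = (∑ ν, (∑ T ∈ (nzSupp x).powerset, permProd (dblOn x T) k ν) / 2 ^ (nzSupp x).card) /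
          d.factorial := by simp_rw [permProd_sq]
    _ = (∑ T ∈ (nzSupp x).powerset, DhatSym d (dblOn x T) k) / 2 ^ (nzSupp x).card := by
        rw [← Finset.sum_div, Finset.sum_comm]
        simp_rw [DhatSym_eq_sum_permProd]
        rw [← Finset.sum_div, div_right_comm]

/-! ### §3. Integration: the Jensen majorant of `W_{n,j}(x)` and the far-node certificates -/

/-- The Jensen sum: `J_{n,l}(x) = 2^{-s} Σ_{T ⊆ supp x} I_{n,l}(2·x|_T)`, `s = # supp x`.
[cite: FitznerVanDerHofstad2016NoBLE, §5.1.2 (5.16) p. 1092] -/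
noncomputable def jensenSum (d n l : ℕ) (x : Fin d → ℤ) : ℝ :=
  (∑ T ∈ (nzSupp x).powerset, srwI d n l (dblOn x T)) / 2 ^ (nzSupp x).card

/-- **`W_{n,j}(x) ≤ 2^{-s} Σ_{T ⊆ supp x} I_{n,2j}(2·x|_T)`** (`2n+1 ≤ d`): integrate `DhatSym_sq_le` against the
non-negative weight `D̂^{2j} Ĉⁿ`. [cite: FitznerVanDerHofstad2016NoBLE, §5.1.2 (5.16) p. 1092; (3.36) p. 1071] -/
theorem srwW_le_jensenSum {n : ℕ} (hd : 2 * n + 1 ≤ d) (j : ℕ) (x : Fin d → ℤ) :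
    srwW d n j x ≤ jensenSum d n (2 * j) x := by
  have hint : ∀ T : Finset (Fin d),
      Integrable (fun k => (Dhat d k ^ (2 * j) * DhatSym d (dblOn x T) k) * Chat d 1 k ^ n) (P d) :=
    fun T => integrable_srwI_integrand hd (2 * j) (dblOn x T)
  have hmono : ∫ k, (Dhat d k ^ (2 * j) * DhatSym d x k ^ 2) * Chat d 1 k ^ n ∂P d ≤
      ∫ k, (∑ T ∈ (nzSupp x).powerset, (Dhat d k ^ (2 * j) * DhatSym d (dblOn x T) k) * Chat d 1 k ^ n) /
        2 ^ (nzSupp x).card ∂P d := by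
    refine integral_mono_of_nonneg (ae_of_all _ fun k => ?_)
      ((integrable_finsetSum _ fun T _ => hint T).div_const _) (ae_of_all _ fun k => ?_)
    · exact mul_nonneg (mul_nonneg (by rw [pow_mul]; exact pow_nonneg (sq_nonneg _) j) (sq_nonneg _))
        (pow_nonneg (Chat_one_nonneg k) n)
    · have hD : 0 ≤ Dhat d k ^ (2 * j) := by rw [pow_mul]; exact pow_nonneg (sq_nonneg _) j
      have hC : 0 ≤ Chat d 1 k ^ n := pow_nonneg (Chat_one_nonneg k) n
      calc (Dhat d k ^ (2 * j) * DhatSym d x k ^ 2) * Chat d 1 k ^ n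
          ≤ (Dhat d k ^ (2 * j) * ((∑ T ∈ (nzSupp x).powerset, DhatSym d (dblOn x T) k) /
              2 ^ (nzSupp x).card)) * Chat d 1 k ^ n := by
            have := DhatSym_sq_le x k
            gcongr
        _ = (∑ T ∈ (nzSupp x).powerset, (Dhat d k ^ (2 * j) * DhatSym d (dblOn x T) k) * Chat d 1 k ^ n) /
              2 ^ (nzSupp x).card := by
            rw [mul_div_assoc', div_mul_eq_mul_div, Finset.mul_sum, Finset.sum_mul]
  have hsum : ∫ k, (∑ T ∈ (nzSupp x).powerset, (Dhat d k ^ (2 * j) * DhatSym d (dblOn x T) k) *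
      Chat d 1 k ^ n) / 2 ^ (nzSupp x).card ∂P d =
      (∑ T ∈ (nzSupp x).powerset, ∫ k, (Dhat d k ^ (2 * j) * DhatSym d (dblOn x T) k) * Chat d 1 k ^ n ∂P d) /
        2 ^ (nzSupp x).card := by
    rw [integral_div, integral_finsetSum _ fun T _ => hint T]
  unfold srwW jensenSum srwI
  rw [← Finset.sum_div, div_right_comm]
  exact div_le_div_of_nonneg_right (hmono.trans_eq hsum) (two_pi_pow_pos d).le

/-- The Jensen sum is non-negative (`2n+1 ≤ d`), dominating `W_{n,j} ≥ 0`.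
[cite: FitznerVanDerHofstad2016NoBLE, §5.1.2 (5.16) p. 1092] -/
theorem jensenSum_nonneg {n : ℕ} (hd : 2 * n + 1 ≤ d) (j : ℕ) (x : Fin d → ℤ) :
    0 ≤ jensenSum d n (2 * j) x :=
  (srwW_nonneg n j x).trans (srwW_le_jensenSum hd j x)

/-- The Jensen sum never exceeds the `x`-uniform cap: `J_{n,2j}(x) ≤ I_{n,2j}(0)` (`1 ≤ n`, `2n+1 ≤ d`;
each term `I_{n,2j}(2x|_T) ≤ I_{n,2j}(0)` by `srwI_le_srwI_zero`, and there are `2^s` terms).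
[cite: FitznerVanDerHofstad2016NoBLE, (5.14) p. 1092] -/
theorem jensenSum_le_srwI_zero {n : ℕ} (hn : 1 ≤ n) (hd : 2 * n + 1 ≤ d) (j : ℕ) (x : Fin d → ℤ) :
    jensenSum d n (2 * j) x ≤ srwI d n (2 * j) 0 := by
  unfold jensenSum
  rw [div_le_iff₀ (by positivity)]
  calc ∑ T ∈ (nzSupp x).powerset, srwI d n (2 * j) (dblOn x T)
      ≤ ∑ T ∈ (nzSupp x).powerset, srwI d n (2 * j) 0 :=
        Finset.sum_le_sum fun T _ => srwI_le_srwI_zero hn hd (2 * j) (dblOn x T)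
    _ = srwI d n (2 * j) 0 * 2 ^ (nzSupp x).card := by
        rw [Finset.sum_const, Finset.card_powerset, nsmul_eq_mul]; push_cast; ring

/-- **Far node, `W`-split + Jensen**: `K_{n,m+j}(x) ≤ √(I_{n,2m}(0)) · √(J_{n,2j}(x))` (`2n+1 ≤ d`).
[cite: FitznerVanDerHofstad2016NoBLE, §5.1.2 (5.16) p. 1092] -/
theorem srwK_le_sqrt_mul_sqrt_jensen {n : ℕ} (hd : 2 * n + 1 ≤ d) (m j : ℕ) (x : Fin d → ℤ) :
    srwK d n (m + j) x ≤ Real.sqrt (srwI d n (2 * m) 0) * Real.sqrt (jensenSum d n (2 * j) x) :=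
  (srwK_le_sqrt_srwI_mul_srwW hd m j x).trans
    (mul_le_mul_of_nonneg_left (Real.sqrt_le_sqrt (srwW_le_jensenSum hd j x)) (Real.sqrt_nonneg _))

/-- **Rational certificate form**: `A ≥ I_{n,2m}(0)`, `B ≥ J_{n,2j}(x)`, `0 ≤ F`, `A·B ≤ F²` give
`K_{n,m+j}(x) ≤ F` (`2n+1 ≤ d`). [cite: FitznerVanDerHofstad2016NoBLE, §5.1.2 (5.16) p. 1092] -/
theorem srwK_le_of_jensen_cert {n : ℕ} (hd : 2 * n + 1 ≤ d) {m j : ℕ} {x : Fin d → ℤ} {A B F : ℝ}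
    (hA : srwI d n (2 * m) 0 ≤ A) (hB : jensenSum d n (2 * j) x ≤ B) (hF : 0 ≤ F) (h : A * B ≤ F ^ 2) :
    srwK d n (m + j) x ≤ F := by
  have hI0 : 0 ≤ srwI d n (2 * m) 0 := srwI_zero_even_nonneg n m
  have hJ0 : 0 ≤ jensenSum d n (2 * j) x := jensenSum_nonneg hd j x
  refine (srwK_le_sqrt_mul_sqrt_jensen hd m j x).trans ?_
  rw [← Real.sqrt_mul hI0]
  calc Real.sqrt (srwI d n (2 * m) 0 * jensenSum d n (2 * j) x)
      ≤ Real.sqrt (A * B) := Real.sqrt_le_sqrt (mul_le_mul hA hB hJ0 (hI0.trans hA))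
    _ ≤ Real.sqrt (F ^ 2) := Real.sqrt_le_sqrt h
    _ = F := Real.sqrt_sq hF

/-- **AM–GM form**: `A ≥ I_{n,2m}(0)`, `B ≥ J_{n,2j}(x)` give `K_{n,m+j}(x) ≤ (A + B)/2` (`2n+1 ≤ d`) — the form a
kernel evaluator adds up class by class. [cite: FitznerVanDerHofstad2016NoBLE, §5.1.2 (5.16) p. 1092] -/
theorem srwK_le_half_add_of_jensen {n : ℕ} (hd : 2 * n + 1 ≤ d) {m j : ℕ} {x : Fin d → ℤ} {A B : ℝ}
    (hA : srwI d n (2 * m) 0 ≤ A) (hB : jensenSum d n (2 * j) x ≤ B) :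
    srwK d n (m + j) x ≤ (A + B) / 2 := by
  have hA0 : 0 ≤ A := (srwI_zero_even_nonneg n m).trans hA
  have hB0 : 0 ≤ B := (jensenSum_nonneg hd j x).trans hB
  exact srwK_le_of_jensen_cert hd hA hB (by positivity) (by nlinarith [sq_nonneg (A - B)])

/-- The even-cut instance used by the `WBX` cell (`n = 1`, cut `2J = J + J`, `d ≥ 3`):
`K_{1,2J}(x) ≤ (A + B)/2` for `A ≥ I_{1,2J}(0)`, `B ≥ J_{1,2J}(x)`.
[cite: FitznerVanDerHofstad2016NoBLE, §5.1.2 (5.16) p. 1092; §5.3.1 (5.36) p. 1098] -/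
theorem srwK_one_even_le_half_add_of_jensen (hd : 3 ≤ d) {J : ℕ} {x : Fin d → ℤ} {A B : ℝ}
    (hA : srwI d 1 (2 * J) 0 ≤ A) (hB : jensenSum d 1 (2 * J) x ≤ B) :
    srwK d 1 (2 * J) x ≤ (A + B) / 2 := by
  rw [two_mul]
  exact srwK_le_half_add_of_jensen (n := 1) (by omega) hA hB

/-! ### §4. Sanity examples -/

/-- The origin: `supp 0 = ∅`, the Jensen sum is the single term `I_{n,l}(0)`. -/
example (n l : ℕ) : jensenSum d n l 0 = srwI d n l 0 := by
  simp [jensenSum, nzSupp]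

/-- One non-zero coordinate: `supp (m e_0) = {0}` (`m ≠ 0`). -/
example (m : ℤ) (hm : m ≠ 0) (hd : 0 < d) : nzSupp (Pi.single (⟨0, hd⟩ : Fin d) m) = {⟨0, hd⟩} := by
  ext i
  simp only [nzSupp, Finset.mem_filter, Finset.mem_univ, true_and, Finset.mem_singleton]
  by_cases h : i = ⟨0, hd⟩
  · subst h; simp [hm]
  · simp [h]

/-- The far node at an even cut through the Jensen hook never pays more than the `x`-uniform cap:
with `A ≥ I_{1,2J}(0)` one may always take `B := A`. -/
example (hd : 3 ≤ d) (J : ℕ) (x : Fin d → ℤ) {A : ℝ} (hA : srwI d 1 (2 * J) 0 ≤ A) :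
    srwK d 1 (2 * J) x ≤ (A + A) / 2 :=
  srwK_one_even_le_half_add_of_jensen hd hA ((jensenSum_le_srwI_zero le_rfl hd J x).trans hA)

end Literature.Probability.FitznerVanDerHofstad2017
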